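import Summits.QuantumFields.YangMills.Theorems.BalabanLadderIRTwistedSlabDefs
import Summits.QuantumFields.YangMills.Theorems.BalabanLadderIRTwistedSlabSectorBounds
import Literature.MathematicalPhysics.QuantumFieldTheory.WilsonFinTorusCyclicFluxProjection
import Literature.MathematicalPhysics.QuantumLattice.TwistEaterIrreducibility
import HarnessLib

/-!
# The projected twisted slab is 't Hooft's `e = 0` flux sector; vacuum dominance and exponential purity ON ONE BOX

HELPER toward stub **T1** `TwistedSlabAnchor` of LINE `twisted-slab-continuity` (crux `IRcof`, stmt-QuantumFields-26930, census
row 43; LEAD prover ym-ir-line-tsc-p1; `--supports` the crux, `--as helper`; part 2 of 2).  Vocabulary: `BalabanLadderIRTwistedSlabDefs`.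

WHAT IS PROVED (every compact `G`, continuous unitary `ρ`, `β ≥ 0`, central `z` with `z ^ n = 1`, `n ≥ 1`, EVERY box `ℓ × ℓ × L`):
* §1 `slabTwist_pow_eq_elecMagTwistTensor`, `projSlabZ_eq_re_magneticFluxPartition` — the e₂-flux projection `projSlabZ` IS 't Hooft's
  flux sector `Re Z_{ψ = 0, m = z}` of lit-4's `wilsonFinTorusMagneticFluxPartition` (finite abelian group `ℤ_n` of central temporal
  twists `slabElecTwist z n k = (1, 1, z^k, 1)`, magnetic tensor `slabMagTwist z`); `projSlabZ_pos`.
* (part 1, `BalabanLadderIRTwistedSlabSectorBounds`: `re_fluxSector_zero_le` (trivial flux sector from above), `defect_le_two_mul_of_sandwich`.)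
* §2 ★ `projSlabZ_vacuumDominated_oneBox` — ONE-BOX VACUUM DOMINANCE of the `e₂ = 0` sector: `λ₀^t ≤ projSlabZ(t) ≤ λ₀^t·(1 + D·τ^{t−2})`
  for all `t ≥ 2`, with `λ₀ = ‖𝕋_m‖ > 0`, `D = projSlabZ(2)/λ₀² − 1 ≥ 0` and Hopf's one-box rate `τ = tanh(3Nβ·ℓ²L) < 1`; hence
  ★ `projSlabDefect_le_exp_oneBox` (`∃ c > 0, C ∀ t ≥ 1, projSlabDefect ≤ C·e^{−ct}`) and `twistedSlabAnchor_oneBox` (T1's binders, `∀ β L ∃ c C`).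
* §3 ★ `twistedSlabAnchor_of_uniform_vacuumDominance` — THE PLUG: T1 follows from the SAME sandwich with `(c, C/L)` UNIFORM in `β ≥ β₀` and
  `L ≥ 2` (`∃ ℓ₀ β₀ c C ∀ β L ∃ λ ∀ t ≥ 2, λ^t ≤ projSlabZ(t) ≤ λ^t(1 + C·L·e^{−ct})`); whoever proves that uniform statement closes
  `stub_anchor` by `exact`.
* §4 `hasIsolatingTwist_suCenter`, `projSlabZ_eq_cyclicFluxProjection` — T1's binders are NOT VACUOUS: `HasIsolatingTwist SU(N) (ω^k·1)` for
  every unit `k` of `ℤ/N` is lit-4's `Literature.MathematicalPhysics.QuantumLattice.suCenter_isolatingTwist` (p653142) read on the line's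
  predicate, and the line's `projSlabZ` is lit-4's cyclic flux projection (`cyclicFluxProjection_slab_eq`, p653821) by `rfl`-transport.

DEDUP ∕ CREDIT: the identification of §1 was typed Literature-side in parallel by ym-ir-lit-4 g11 (`WilsonFinTorusCyclicFluxProjection`,
p653821: `cyclicTemporalTwist z 2 n` = this vocabulary's `slabElecTwist z n` pointwise, `cyclicFluxProjection_slab_eq`); §1 keeps its own
short proofs against the landed `…TwistedSlabDefs` names and §4 records the bridge; the group theory of `HasIsolatingTwist` for `SU(N)` is
ENTIRELY lit-4's `TwistEaterIrreducibility` (p653142 ∕ p653524) — nothing of it is re-proved here.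

CENSUS READING: the quantifier order is the whole content — §2 is `∀ (β, ℓ, L) ∃ (c, C)` (Hopf's box rate `−log tanh(3Nβ·ℓ²L)`), T1 is
`∃ (ℓ₀, β₀, c, C) ∀ (β ≥ β₀, L ≥ 2)`: a β- AND L-uniform gap plus state counting for the `e₂ = 0` sector of the twisted femto tube (a
weak-coupling cluster expansion about the isolated twist-eating vacuum in infinite 2-d volume); T1's group-theoretic binders enter ONLY there.

HONEST FRAMING: one-box transfer-operator bookkeeping with box-dependent constants (width 0 toward `L ≍ ξ` by itself); T1 proper is NOT
proved here (0∕1); nothing here proves `IRcof`, `IR`, any leg, or the Yang–Mills mass gap (Clay: NOT proved); R4 = `BalabanLadder.UV` only.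

References: 't Hooft NPB 153 (1979) §§4–5; Lüscher CMP 54 (1977); Hopf J. Math. Mech. 12 (1963) Thm 4; Reed–Simon IV Thm XIII.43–44.
-/

set_option autoImplicit false

noncomputable section

open MeasureTheory Filter Function Finset
open scoped BigOperators ENNReal ComplexConjugate
open Literature.Analysis.OperatorTheory Literature.MathematicalPhysics.QuantumFieldTheory

namespace Summit.QuantumFields.YangMills.Cruxes.IRcof.TwistedSlab

/-! ## §1 The e-flux projection is 't Hooft's `ψ = 0` flux sector in the magnetic sector `z` -/

section FluxSector

variable {G : Type*} [Group G]

/-- The slab tensor with electric entry `z ^ k` is the electric∕magnetic tensor of the pair (`slabElecTwist z n k`, `slabMagTwist z`).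
[cite: tHooft1979Flux, §2 (2.5)] -/
theorem slabTwist_pow_eq_elecMagTwistTensor (z : G) (n : ℕ) (k : ZMod n) :
    slabTwist z (z ^ k.val) = elecMagTwistTensor (slabElecTwist z n k) (slabMagTwist z) := by
  funext μ ν
  fin_cases μ <;> fin_cases ν <;> simp [slabTwist, slabElecTwist, slabMagTwist, elecMagTwistTensor]

/-- No electric twist at `k = 0`: `slabElecTwist z n 0 = 1`. [cite: tHooft1979Flux, §4 (4.4)] -/
theorem slabElecTwist_zero (z : G) (n : ℕ) [NeZero n] : slabElecTwist z n 0 = 1 := by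
  funext μ
  simp [slabElecTwist, ZMod.val_zero]

/-- Group law of the electric twists for `z ^ n = 1`: `slabElecTwist z n (k + k') = slabElecTwist z n k * slabElecTwist z n k'`
('t Hooft's `Ω[k₁]Ω[k₂] = Ω[k₁ + k₂]`). [cite: tHooft1979Flux, §4 (4.4)] -/
theorem slabElecTwist_add {z : G} {n : ℕ} [NeZero n] (hzn : z ^ n = 1) (k k' : ZMod n) :
    slabElecTwist z n (k + k') = slabElecTwist z n k * slabElecTwist z n k' := by
  have hmod : ∀ q : ℕ, z ^ (q % n) = z ^ q := fun q => by
    conv_rhs => rw [← Nat.mod_add_div q n, pow_add, pow_mul, hzn, one_pow, mul_one]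
  funext μ
  by_cases hμ : μ = 2
  · simp only [slabElecTwist, hμ, if_true, Pi.mul_apply]
    rw [ZMod.val_add, hmod, pow_add]
  · simp [slabElecTwist, hμ]

/-- The spatial entries of every electric twist are central (indeed only the entry `2` is non-trivial, and it is a power of the
central `z`). [folklore] -/
theorem slabElecTwist_castSucc_mem_center {z : G} (hz : z ∈ Subgroup.center G) (n : ℕ) (k : ZMod n) (i : Fin 3) :
    slabElecTwist z n k i.castSucc ∈ Subgroup.center G := by
  unfold slabElecTwist
  split_ifs
  · exact Subgroup.pow_mem _ hz _
  · exact Subgroup.one_mem _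

variable [TopologicalSpace G] [IsTopologicalGroup G] [CompactSpace G] [MeasurableSpace G] [BorelSpace G]
  {N : ℕ} (ρ : G →* Matrix (Fin N) (Fin N) ℂ)

/-- ★ **The e-flux projection is 't Hooft's flux sector `e = 0` at magnetic flux `z`**:
`projSlabZ ρ β z (m+1) ℓ L t = Re Z_{ψ = 0, m}(ℓ, ℓ, L, t)` for the group `ℤ_{m+1}` of electric twists `slabElecTwist z (m+1)` and the
magnetic tensor `slabMagTwist z` — verbatim (5.4) at `e = 0`. [cite: tHooft1979Flux, §5 (5.2)–(5.4)] -/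
theorem projSlabZ_eq_re_magneticFluxPartition (β : ℝ) (z : G) (m ℓ L t : ℕ) :
    projSlabZ ρ β z (m + 1) ℓ L t =
      (wilsonFinTorusMagneticFluxPartition ρ β (slabMagTwist z) (slabElecTwist z (m + 1)) 0 ℓ ℓ L t).re := by
  rw [wilsonFinTorusMagneticFluxPartition_def]
  have hW : ∀ k : ZMod (m + 1),
      wilsonFinTorusTensorTwistedPartition ρ β (elecMagTwistTensor (slabElecTwist z (m + 1) k) (slabMagTwist z)) ℓ ℓ L t =
        wilsonFinTorusTensorTwistedPartition ρ β (slabTwist z (z ^ k.val)) ℓ ℓ L t := fun k => by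
    rw [slabTwist_pow_eq_elecMagTwistTensor]
  simp only [AddChar.zero_apply, map_one, one_mul, hW, ZMod.card]
  unfold projSlabZ
  rw [← Complex.ofReal_natCast, ← Complex.ofReal_inv]
  have hs : (∑ k : ZMod (m + 1), (wilsonFinTorusTensorTwistedPartition ρ β (slabTwist z (z ^ k.val)) ℓ ℓ L t : ℂ)) =
      ((∑ k : Fin (m + 1), wilsonFinTorusTensorTwistedPartition ρ β (slabTwist z (z ^ (k : ℕ))) ℓ ℓ L t : ℝ) : ℂ) := by
    rw [Complex.ofReal_sum]
    rfl
  rw [hs, ← Complex.ofReal_mul, Complex.ofReal_re]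

/-- **`projSlabZ > 0`**: a finite average of positive twisted partition functions (`n ≥ 1`, all sides `≥ 1`, continuous `ρ`).
[folklore] -/
theorem projSlabZ_pos [SecondCountableTopology G] (hρ : Continuous ρ) (β : ℝ) (z : G) {n : ℕ} (hn : 0 < n)
    (ℓ L t : ℕ) : 0 < projSlabZ ρ β z n ℓ L t := by
  unfold projSlabZ
  have hn' : (0 : ℝ) < n := by exact_mod_cast hn
  haveI : Nonempty (Fin n) := ⟨⟨0, hn⟩⟩
  refine mul_pos (inv_pos.2 hn') (Finset.sum_pos (fun k _ => ?_) Finset.univ_nonempty)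
  exact wilsonFinTorusTensorTwistedPartition_pos ρ hρ β _ ℓ ℓ L t

/-- **`projSlabZ ≥ 0`** for every box (empty boxes included: the integrand is an exponential). [folklore] -/
theorem projSlabZ_nonneg (β : ℝ) (z : G) (n ℓ L t : ℕ) : 0 ≤ projSlabZ ρ β z n ℓ L t :=
  mul_nonneg (inv_nonneg.2 (Nat.cast_nonneg _))
    (Finset.sum_nonneg fun _ _ => integral_nonneg fun _ => (Real.exp_pos _).le)

/-- **`projSlabDefect ≤ 1`** on every box: the subtracted ratio is non-negative. [folklore] -/
theorem projSlabDefect_le_one (β : ℝ) (z : G) (n ℓ L t : ℕ) : projSlabDefect ρ β z n ℓ L t ≤ 1 :=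
  sub_le_self _ (div_nonneg (projSlabZ_nonneg ρ β z n ℓ L _) (sq_nonneg _))

end FluxSector

/-! ## §2 One box: vacuum dominance of the `e₂ = 0` sector and exponential purity (box-dependent constants) -/

section OneBox

variable {G : Type*} [Group G] [TopologicalSpace G] [IsTopologicalGroup G] [CompactSpace G]
  [MeasurableSpace G] [BorelSpace G] [SecondCountableTopology G] {N : ℕ} {ρ : G →* Matrix (Fin N) (Fin N) ℂ}

/-- ★ **ONE-BOX VACUUM DOMINANCE OF THE PROJECTED TWISTED SLAB** (`β ≥ 0`, continuous unitary `ρ`, central `z` with `z ^ (m+1) = 1`, every box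
`ℓ × ℓ × L`).  With `λ₀ = ‖𝕋_m‖ > 0` the norm of the transfer operator of the magnetically twisted spatial box, `D ≥ 0` the excited weight of
the flux-free sector at period `2` (`projSlabZ(2) = λ₀²·(1 + D)`) and Hopf's one-box rate `τ = tanh(3Nβ·ℓ·ℓ·L)`:
`λ₀^{M+2} ≤ projSlabZ(M+2) ≤ λ₀^{M+2}·(1 + D·τ^M)` for every `M` — the `e₂ = 0` thermal trace is the vacuum exponential up to excitations
decaying at the finite-volume gap.  HONEST: `τ` and `D` depend on `β`, `ℓ`, `L`; this is NOT the β-uniform anchor T1.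
[cite: tHooft1979Flux, §5 (5.1)–(5.4)] [cite: Hopf1963, Thm 4] [cite: ReedSimonIV1978, Thm XIII.43 and Thm XIII.44] -/
theorem projSlabZ_vacuumDominated_oneBox (hρ : Continuous ρ) (hρu : ∀ g, ρ g ∈ Matrix.unitaryGroup (Fin N) ℂ)
    {β : ℝ} (hβ : 0 ≤ β) {z : G} (hz : z ∈ Subgroup.center G) {m : ℕ} (hzn : z ^ (m + 1) = 1) (ℓ L : ℕ) :
    ∃ lam₀ D : ℝ, 0 < lam₀ ∧ 0 ≤ D ∧ ∀ M : ℕ,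
      lam₀ ^ (M + 2) ≤ projSlabZ ρ β z (m + 1) ℓ L (M + 2) ∧
      projSlabZ ρ β z (m + 1) ℓ L (M + 2) ≤
        lam₀ ^ (M + 2) * (1 + D * Real.tanh (3 * N * β * ((ℓ : ℝ) * ℓ * L)) ^ M) := by
  haveI : IsFiniteMeasure (haarProbability G) := by
    dsimp [haarProbability]; infer_instance
  set zM : Fin 4 → Fin 4 → G := slabMagTwist z with hzM
  set φ : ZMod (m + 1) → Fin 4 → G := slabElecTwist z (m + 1) with hφ
  have hφ0 : φ 0 = 1 := slabElecTwist_zero z (m + 1)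
  have hφadd : ∀ k k', φ (k + k') = φ k * φ k' := slabElecTwist_add hzn
  have hφc : ∀ k (i : Fin 3), φ k i.castSucc ∈ Subgroup.center G := fun k i => slabElecTwist_castSucc_mem_center hz _ k i
  obtain ⟨C, A, s, hcnt, b, lam, i₀, hC, hA, hb, hlam, hi₀, hL0⟩ :=
    exists_eigenbasis_finTorusSliceKernelTw hρ hρu hβ (finSliceTwistTensor zM : FinSpatialSite ℓ ℓ L → Fin 3 → Fin 3 → G)
  haveI : Countable s := hcnt
  have hK := stronglyMeasurable_uncurry_finTorusSliceKernelTw (b₁ := ℓ) (b₂ := ℓ) (b₃ := L) ρ hρ β (finSliceTwistTensor zM)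
  have hsymm : ∀ x y : FinSpatialSite ℓ ℓ L × Fin 3 → G,
      finTorusSliceKernelTw ρ β (finSliceTwistTensor zM) x y = finTorusSliceKernelTw ρ β (finSliceTwistTensor zM) y x :=
    finTorusSliceKernelTw_symm ρ hρu β _
  have hKpos : ∀ x y : FinSpatialSite ℓ ℓ L × Fin 3 → G, 0 < finTorusSliceKernelTw ρ β (finSliceTwistTensor zM) x y :=
    finTorusSliceKernelTw_pos ρ hρ β _
  have hT0 : (finSliceTwist (φ 0) : (FinSpatialSite ℓ ℓ L × Fin 3 → G) → _) = id := by
    rw [hφ0]; exact finSliceTwist_one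
  have hTadd : ∀ (k k' : ZMod (m + 1)) (x : FinSpatialSite ℓ ℓ L × Fin 3 → G),
      finSliceTwist (φ (k + k')) x = finSliceTwist (φ k) (finSliceTwist (φ k') x) := fun k k' x => by
    rw [finSliceTwist_finSliceTwist, hφadd]
  have hT : ∀ k : ZMod (m + 1), MeasurePreserving (finSliceTwist (φ k) : (FinSpatialSite ℓ ℓ L × Fin 3 → G) → _)
      (Measure.pi fun _ => haarProbability G) (Measure.pi fun _ => haarProbability G) :=
    fun k => measurePreserving_finSliceTwist (φ k)
  have hKT : ∀ (k : ZMod (m + 1)) (x y : FinSpatialSite ℓ ℓ L × Fin 3 → G),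
      finTorusSliceKernelTw ρ β (finSliceTwistTensor zM) (finSliceTwist (φ k) x) (finSliceTwist (φ k) y) =
        finTorusSliceKernelTw ρ β (finSliceTwistTensor zM) x y :=
    fun k x y => finTorusSliceKernelTw_finSliceTwist ρ (hφc k) β _ x y
  have hzz : ∀ (k : ZMod (m + 1)) (M : ℕ),
      (fun k n => wilsonFinTorusTensorTwistedPartition ρ β (elecMagTwistTensor (φ k) zM) ℓ ℓ L n) k (M + 2) =
      ∫ x, ((fun f : (FinSpatialSite ℓ ℓ L × Fin 3 → G) → ℝ => fun u =>
            ∫ y, finTorusSliceKernelTw ρ β (finSliceTwistTensor zM) u y * f y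
              ∂(Measure.pi fun _ : FinSpatialSite ℓ ℓ L × Fin 3 => haarProbability G))^[M + 1]
          (fun y => finTorusSliceKernelTw ρ β (finSliceTwistTensor zM) y x)) (finSliceTwist (φ k) x)
        ∂(Measure.pi fun _ : FinSpatialSite ℓ ℓ L × Fin 3 => haarProbability G) :=
    fun k M => wilsonFinTorusTensorTwistedPartition_elecMag_eq_integral_iterate ρ hρ β (hφc k) zM ℓ ℓ L M
  have hlam0 : ∀ i, 0 ≤ lam i := fun i => (hlam i).1
  -- Hopf's ratio bound in the magnetic sector: `λᵢ ≤ τ λ₀` off the top index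
  have hHopf : ∀ i, i ≠ i₀ → lam i ≤ Real.tanh (3 * N * β * ((ℓ : ℝ) * ℓ * L)) * lam i₀ := fun i hi => by
    have h := WilsonFinTorusHopfTw.abs_eigenvalue_le_tanh_mul (b₁ := ℓ) (b₂ := ℓ) (b₃ := L) ρ hρ hρu hβ
      (finSliceTwistTensor zM) hA b hb hi₀ hi
    rw [← hi₀] at h
    exact (le_abs_self _).trans h
  have hlam₀pos : 0 < lam i₀ := lt_of_le_of_ne (hlam0 i₀) (Ne.symm hL0)
  -- the sector bounds, read on `projSlabZ` through §1
  have hlow : ∀ M : ℕ, lam i₀ ^ M * lam i₀ ^ 2 ≤ projSlabZ ρ β z (m + 1) ℓ L (M + 2) := fun M => by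
    rw [projSlabZ_eq_re_magneticFluxPartition]
    exact le_re_fluxSector_zero (T := fun k => finSliceTwist (φ k)) hK hC hsymm hKpos hA hb hlam0 hi₀ hL0 hT hT0
      hTadd hKT hzz M
  have hup : ∀ M : ℕ, projSlabZ ρ β z (m + 1) ℓ L (M + 2) ≤ lam i₀ ^ M * lam i₀ ^ 2 +
      (Real.tanh (3 * N * β * ((ℓ : ℝ) * ℓ * L)) * lam i₀) ^ M * (projSlabZ ρ β z (m + 1) ℓ L 2 - lam i₀ ^ 2) := fun M => by
    rw [projSlabZ_eq_re_magneticFluxPartition, projSlabZ_eq_re_magneticFluxPartition]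
    exact re_fluxSector_zero_le (T := fun k => finSliceTwist (φ k)) hK hC hsymm hKpos hA hb hlam0 hi₀ hL0 hHopf hT hT0
      hTadd hKT hzz M
  -- package: `D := projSlabZ(2)/λ₀² − 1 ≥ 0`
  have h2 : lam i₀ ^ 2 ≤ projSlabZ ρ β z (m + 1) ℓ L 2 := by
    have h := hlow 0
    rwa [pow_zero, one_mul] at h
  have hl2 : 0 < lam i₀ ^ 2 := by positivity
  refine ⟨lam i₀, (projSlabZ ρ β z (m + 1) ℓ L 2 - lam i₀ ^ 2) / lam i₀ ^ 2, hlam₀pos,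
    div_nonneg (sub_nonneg.2 h2) hl2.le, fun M => ⟨?_, ?_⟩⟩
  · calc lam i₀ ^ (M + 2) = lam i₀ ^ M * lam i₀ ^ 2 := pow_add _ _ _
      _ ≤ _ := hlow M
  · calc projSlabZ ρ β z (m + 1) ℓ L (M + 2)
        ≤ lam i₀ ^ M * lam i₀ ^ 2 +
            (Real.tanh (3 * N * β * ((ℓ : ℝ) * ℓ * L)) * lam i₀) ^ M * (projSlabZ ρ β z (m + 1) ℓ L 2 - lam i₀ ^ 2) := hup M
      _ = lam i₀ ^ (M + 2) * (1 + (projSlabZ ρ β z (m + 1) ℓ L 2 - lam i₀ ^ 2) / lam i₀ ^ 2 *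
            Real.tanh (3 * N * β * ((ℓ : ℝ) * ℓ * L)) ^ M) := by
          rw [mul_pow, pow_add]
          field_simp

/-- ★ **ONE-BOX EXPONENTIAL PURITY OF THE PROJECTED TWISTED SLAB.**  For `β ≥ 0`, continuous unitary `ρ`, central `z` with `z ^ n = 1`,
`n ≥ 1`, and EVERY box `ℓ × ℓ × L`: there are `c > 0` and `C` with `projSlabDefect ρ β z n ℓ L t ≤ C·e^{−ct}` for all `t ≥ 1`.  Mechanism:
one-box vacuum dominance (`projSlabZ_vacuumDominated_oneBox`) and `defect_le_two_mul_of_sandwich`; the rate is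
`c = −log max(τ, 1/2)` with Hopf's `τ = tanh(3Nβ·ℓ²L)`.  HONEST: `c, C` depend on the box and on `β` (the rate degrades like
`e^{−6Nβℓ²L}`); T1 = `TwistedSlabAnchor` asks for `c` and `C/L` UNIFORM in `β ≥ β₀`, `L ≥ 2` and is NOT proved here.
[cite: tHooft1979Flux, §5 (5.1)–(5.4)] [cite: Hopf1963, Thm 4] -/
theorem projSlabDefect_le_exp_oneBox (hρ : Continuous ρ) (hρu : ∀ g, ρ g ∈ Matrix.unitaryGroup (Fin N) ℂ)
    {β : ℝ} (hβ : 0 ≤ β) {z : G} (hz : z ∈ Subgroup.center G) {n : ℕ} (hn : 0 < n) (hzn : z ^ n = 1) (ℓ L : ℕ) :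
    ∃ c C : ℝ, 0 < c ∧ 0 ≤ C ∧ ∀ t : ℕ, 1 ≤ t →
      projSlabDefect ρ β z n ℓ L t ≤ C * Real.exp (-(c * (t : ℝ))) := by
  obtain ⟨m, rfl⟩ : ∃ m, n = m + 1 := ⟨n - 1, by omega⟩
  obtain ⟨lam₀, D, hlam₀, hD, hsand⟩ := projSlabZ_vacuumDominated_oneBox hρ hρu hβ hz hzn ℓ L
  set τ : ℝ := Real.tanh (3 * N * β * ((ℓ : ℝ) * ℓ * L)) with hτ
  set τ' : ℝ := max τ (1 / 2) with hτ'
  have hτ0 : 0 ≤ τ := by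
    rw [hτ]
    have h0 : (0 : ℝ) ≤ 3 * N * β * ((ℓ : ℝ) * ℓ * L) := by positivity
    rw [Real.tanh_eq_sinh_div_cosh]
    exact div_nonneg (Real.sinh_nonneg_iff.2 h0) (Real.cosh_pos _).le
  have hτ1 : τ < 1 := by rw [hτ]; exact Real.tanh_lt_one _
  have hτ'pos : 0 < τ' := lt_of_lt_of_le (by norm_num) (le_max_right _ _)
  have hτ'1 : τ' < 1 := max_lt hτ1 (by norm_num)
  have hττ' : τ ≤ τ' := le_max_left _ _
  -- the rate `c := −log τ' > 0`, so that `τ'^M = e^{−c M}`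
  set c : ℝ := -Real.log τ' with hc
  have hcpos : 0 < c := by rw [hc, neg_pos]; exact Real.log_neg hτ'pos hτ'1
  have hτ'exp : ∀ M : ℕ, τ' ^ M = Real.exp (-(c * M)) := fun M => by
    rw [hc, neg_mul, neg_neg, mul_comm, Real.exp_nat_mul, Real.exp_log hτ'pos]
  refine ⟨c, max (2 * D * Real.exp (2 * c)) (Real.exp c), hcpos, le_max_of_le_right (Real.exp_pos _).le, fun t ht => ?_⟩
  rcases Nat.lt_or_ge t 2 with ht2 | ht2
  · -- `t = 1`: the defect is `≤ 1 = e^{c}·e^{−c}`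
    obtain rfl : t = 1 := by omega
    calc projSlabDefect ρ β z (m + 1) ℓ L 1 ≤ 1 := projSlabDefect_le_one ρ β z _ ℓ L 1
      _ = Real.exp c * Real.exp (-(c * ((1 : ℕ) : ℝ))) := by
          rw [Nat.cast_one, mul_one, ← Real.exp_add, add_neg_cancel, Real.exp_zero]
      _ ≤ max (2 * D * Real.exp (2 * c)) (Real.exp c) * Real.exp (-(c * ((1 : ℕ) : ℝ))) :=
          mul_le_mul_of_nonneg_right (le_max_right _ _) (Real.exp_pos _).le
  · -- `t = M + 2`: vacuum dominance + the purity lemma with `S = D τ^M ≤ D e^{2c} e^{−ct}`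
    obtain ⟨M, rfl⟩ : ∃ M, t = M + 2 := ⟨t - 2, by omega⟩
    obtain ⟨hlo, hhi⟩ := hsand M
    obtain ⟨hlo2, -⟩ := hsand (2 * M + 2)
    have hP2 : (lam₀ ^ (M + 2)) ^ 2 ≤ projSlabZ ρ β z (m + 1) ℓ L (2 * (M + 2)) := by
      rw [← pow_mul, show (M + 2) * 2 = 2 * M + 2 + 2 by ring, show 2 * (M + 2) = 2 * M + 2 + 2 by ring]
      exact hlo2
    have ha : 0 < lam₀ ^ (M + 2) := pow_pos hlam₀ _
    have hS : 0 ≤ D * τ ^ M := mul_nonneg hD (pow_nonneg hτ0 M)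
    have hdef : projSlabDefect ρ β z (m + 1) ℓ L (M + 2) ≤ 2 * (D * τ ^ M) := by
      unfold projSlabDefect
      exact defect_le_two_mul_of_sandwich ha hS hP2 hhi hlo
    have hτM : τ ^ M ≤ Real.exp (2 * c) * Real.exp (-(c * ((M + 2 : ℕ) : ℝ))) := by
      calc τ ^ M ≤ τ' ^ M := pow_le_pow_left₀ hτ0 hττ' M
        _ = Real.exp (-(c * M)) := hτ'exp M
        _ = Real.exp (2 * c) * Real.exp (-(c * ((M + 2 : ℕ) : ℝ))) := by
            rw [← Real.exp_add]; congr 1; push_cast; ring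
    calc projSlabDefect ρ β z (m + 1) ℓ L (M + 2) ≤ 2 * (D * τ ^ M) := hdef
      _ ≤ 2 * (D * (Real.exp (2 * c) * Real.exp (-(c * ((M + 2 : ℕ) : ℝ))))) :=
          mul_le_mul_of_nonneg_left (mul_le_mul_of_nonneg_left hτM hD) (by norm_num)
      _ = (2 * D * Real.exp (2 * c)) * Real.exp (-(c * ((M + 2 : ℕ) : ℝ))) := by ring
      _ ≤ max (2 * D * Real.exp (2 * c)) (Real.exp c) * Real.exp (-(c * ((M + 2 : ℕ) : ℝ))) :=
          mul_le_mul_of_nonneg_right (le_max_left _ _) (Real.exp_pos _).le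

end OneBox

/-! ## §3 The binders of T1: the one-box reading, and the plug through which a UNIFORM vacuum dominance closes T1 -/

/-- **T1's conclusion on every single box, with box-dependent constants and NONE of T1's group-theoretic binders**: for every compact
group `G` (Borel σ-algebra), every central `z` with `z ^ n = 1`, `n ≥ 1`, every lattice representation `r`, every transverse size `ℓ`, every
`β ≥ 0` and every `L`, there are `c > 0`, `C` with `projSlabDefect r.ρ β z n ℓ L t ≤ C·e^{−ct}` for all `t ≥ 1`.  Compare
`TwistedSlabAnchor` (T1): `∃ (ℓ₀, β₀, c, C) ∀ (β ≥ β₀, L ≥ 2)` with the bound `C·L·e^{−ct}` — simplicity, simple connectivity, `z ≠ 1` and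
`HasIsolatingTwist` can matter only for that UNIFORMITY.  HONEST: width 0 toward T1 by itself. [cite: tHooft1979Flux, §5 (5.1)–(5.4)]
[cite: Hopf1963, Thm 4] -/
theorem twistedSlabAnchor_oneBox :
    ∀ (G : Type) [Group G] [TopologicalSpace G] [IsTopologicalGroup G] [CompactSpace G],
      letI : MeasurableSpace G := borel G
      haveI : BorelSpace G := ⟨rfl⟩
      ∀ (z : G) (n : ℕ), z ∈ Subgroup.center G → 0 < n → z ^ n = 1 →
        ∀ (r : LatticeRep G) (ℓ : ℕ) (β : ℝ), 0 ≤ β → ∀ L : ℕ, ∃ c C : ℝ, 0 < c ∧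
          ∀ t : ℕ, 1 ≤ t → projSlabDefect r.ρ β z n ℓ L t ≤ C * Real.exp (-(c * (t : ℝ))) := by
  intro G _ _ _ _
  letI : MeasurableSpace G := borel G
  haveI : BorelSpace G := ⟨rfl⟩
  intro z n hz hn hzn r ℓ β hβ L
  haveI : SecondCountableTopology G :=
    (r.continuous.isClosedEmbedding r.injective).isEmbedding.secondCountableTopology
  obtain ⟨c, C, hc, -, h⟩ := projSlabDefect_le_exp_oneBox r.continuous r.mem_unitary hβ hz hn hzn ℓ L
  exact ⟨c, C, hc, h⟩

/-- ★ **THE PLUG: T1 from UNIFORM vacuum dominance of the `e₂ = 0` sector.**  If, in the binders of T1, the projected twisted femto slab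
satisfies the two-sided sandwich `λ^t ≤ projSlabZ(t) ≤ λ^t·(1 + C·L·e^{−ct})` (`t ≥ 2`) with `(c, C)` chosen BEFORE `β ≥ β₀` and `L ≥ 2`
(and `λ = λ(β, L) > 0` after), then `TwistedSlabAnchor` holds (constant `max (2C) (e^c)`, same `ℓ₀, β₀, c`).  This is exactly the shape
`projSlabZ_vacuumDominated_oneBox` delivers on one box with box-dependent `(c, C)`; the hypothesis is the β- and L-UNIFORM version —
the open content of T1 (a weak-coupling cluster expansion about the isolated twist-eating vacuum; not in print).  HONEST: an implication;
its hypothesis is NOT proved anywhere. [cite: tHooft1979Flux, §5 (5.1)–(5.4)] -/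
theorem twistedSlabAnchor_of_uniform_vacuumDominance
    (h : ∀ (G : Type) [Group G] [TopologicalSpace G] [IsTopologicalGroup G] [CompactSpace G],
      IsCompactSimpleLieGroup G → SimplyConnectedSpace G →
      letI : MeasurableSpace G := borel G
      haveI : BorelSpace G := ⟨rfl⟩
      ∀ (z : G) (n : ℕ), z ∈ Subgroup.center G → z ≠ 1 → 0 < n → z ^ n = 1 → HasIsolatingTwist G z →
        ∀ r : LatticeRep G, ∃ (ℓ₀ : ℕ) (β₀ c C : ℝ), 2 ≤ ℓ₀ ∧ 0 < c ∧ 0 ≤ C ∧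
          ∀ β : ℝ, β₀ ≤ β → ∀ L : ℕ, 2 ≤ L → ∃ lam : ℝ, 0 < lam ∧ ∀ t : ℕ, 2 ≤ t →
            lam ^ t ≤ projSlabZ r.ρ β z n ℓ₀ L t ∧
            projSlabZ r.ρ β z n ℓ₀ L t ≤ lam ^ t * (1 + C * (L : ℝ) * Real.exp (-(c * (t : ℝ))))) :
    TwistedSlabAnchor := by
  intro G _ _ _ _ hG hsc
  letI : MeasurableSpace G := borel G
  haveI : BorelSpace G := ⟨rfl⟩
  intro z n hz hz1 hn hzn hiso r
  obtain ⟨ℓ₀, β₀, c, C, hℓ₀, hc, hC0, hunif⟩ := h G hG hsc z n hz hz1 hn hzn hiso r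
  refine ⟨ℓ₀, β₀, c, max (2 * C) (Real.exp c), hℓ₀, hc, fun β hβ L t hL ht => ?_⟩
  obtain ⟨lam, hlam, hsand⟩ := hunif β hβ L hL
  have hL1 : (1 : ℝ) ≤ L := by exact_mod_cast (show 1 ≤ L by omega)
  have hmax0 : 0 ≤ max (2 * C) (Real.exp c) := le_max_of_le_right (Real.exp_pos _).le
  rcases Nat.lt_or_ge t 2 with ht2 | ht2
  · -- `t = 1`: defect `≤ 1 ≤ e^{c}·L·e^{−c}`
    obtain rfl : t = 1 := by omega
    calc projSlabDefect r.ρ β z n ℓ₀ L 1 ≤ 1 := projSlabDefect_le_one r.ρ β z n ℓ₀ L 1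
      _ = Real.exp c * 1 * Real.exp (-(c * ((1 : ℕ) : ℝ))) := by
          rw [mul_one, Nat.cast_one, mul_one, ← Real.exp_add, add_neg_cancel, Real.exp_zero]
      _ ≤ max (2 * C) (Real.exp c) * (L : ℝ) * Real.exp (-(c * ((1 : ℕ) : ℝ))) := by
          gcongr
          exact le_max_right _ _
  · obtain ⟨hlo, hhi⟩ := hsand t ht2
    obtain ⟨hlo2, -⟩ := hsand (2 * t) (by omega)
    have hP2 : (lam ^ t) ^ 2 ≤ projSlabZ r.ρ β z n ℓ₀ L (2 * t) := by rw [← pow_mul, mul_comm]; exact hlo2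
    have hS : 0 ≤ C * (L : ℝ) * Real.exp (-(c * (t : ℝ))) := by positivity
    have hdef : projSlabDefect r.ρ β z n ℓ₀ L t ≤ 2 * (C * (L : ℝ) * Real.exp (-(c * (t : ℝ)))) := by
      unfold projSlabDefect
      exact defect_le_two_mul_of_sandwich (pow_pos hlam t) hS hP2 hhi hlo
    calc projSlabDefect r.ρ β z n ℓ₀ L t ≤ 2 * (C * (L : ℝ) * Real.exp (-(c * (t : ℝ)))) := hdef
      _ = (2 * C) * (L : ℝ) * Real.exp (-(c * (t : ℝ))) := by ring
      _ ≤ max (2 * C) (Real.exp c) * (L : ℝ) * Real.exp (-(c * (t : ℝ))) := by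
          gcongr
          exact le_max_left _ _

/-! ## §4 Non-vacuity of T1's binders for `SU(N)` and the bridge to lit-4's cyclic flux projection -/

section Bridge

/-- **T1's group-theoretic binders are not vacuous**: for `N ≥ 1` and every unit `k` of `ℤ/N`, the centre element `ω^k·1 ∈ SU(N)`
carries an ISOLATING twist in the sense of the line's `HasIsolatingTwist` — existence of a twist-eating pair, simultaneous conjugacy of all
such pairs, finiteness of their centraliser.  This is lit-4's `suCenter_isolatingTwist` verbatim (González-Arroyo 1998 §4.2;
García Pérez–González-Arroyo–Okawa 2014 §2); with `suCenter_ne_one_of_isUnit` (`N ≥ 2`), `suCenter_pow_card` and `(suCenter N k).2` every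
hypothesis of T1 on `(z, n) = (ω^k·1, N)` is met by `SU(N)`. [cite: Gonzalezarroyo1998, §4.2] -/
theorem hasIsolatingTwist_suCenter {N : ℕ} [NeZero N] {k : ZMod N} (hk : IsUnit k) :
    HasIsolatingTwist (Matrix.specialUnitaryGroup (Fin N) ℂ)
      (Literature.MathematicalPhysics.QuantumLattice.suCenter N k : Matrix.specialUnitaryGroup (Fin N) ℂ) :=
  Literature.MathematicalPhysics.QuantumLattice.suCenter_isolatingTwist hk

variable {G : Type*} [Group G]

/-- The line's electric twist family is lit-4's cyclic temporal twist on axis `2`: `slabElecTwist z n k = cyclicTemporalTwist z 2 n k`.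
[cite: tHooft1979Flux, §4 (4.2)] -/
theorem slabElecTwist_eq_cyclicTemporalTwist (z : G) (n : ℕ) (k : ZMod n) :
    slabElecTwist z n k = cyclicTemporalTwist z 2 n k := by
  funext μ
  fin_cases μ <;> simp [slabElecTwist, cyclicTemporalTwist]

variable [TopologicalSpace G] [IsTopologicalGroup G] [CompactSpace G] [MeasurableSpace G] [BorelSpace G]
  {N : ℕ} (ρ : G →* Matrix (Fin N) (Fin N) ℂ)

/-- **The line's `projSlabZ` is lit-4's cyclic flux projection** (`cyclicFluxProjection_slab_eq`, p653821), transported to the landed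
vocabulary: `projSlabZ ρ β z n ℓ L t = Re Z^{ℤ/n}_{0, z@(0,1)}(ℓ, ℓ, L, t)` for every `n ≥ 1` (same content as
`projSlabZ_eq_re_magneticFluxPartition`, stated with `cyclicTemporalTwist z 2 n`). [cite: tHooft1979Flux, §5 (5.2)–(5.4)] -/
theorem projSlabZ_eq_cyclicFluxProjection {n : ℕ} [NeZero n] (β : ℝ) (z : G) (ℓ L t : ℕ) :
    projSlabZ ρ β z n ℓ L t =
      (wilsonFinTorusMagneticFluxPartition ρ β (slabMagTwist z) (cyclicTemporalTwist z 2 n) 0 ℓ ℓ L t).re :=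
  cyclicFluxProjection_slab_eq ρ β z z ℓ ℓ L t

end Bridge

end Summit.QuantumFields.YangMills.Cruxes.IRcof.TwistedSlab

end
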